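import Summits.AtomisticToContinuum.HydrodynamicLimit.Theorems.OneFlightGossipEngineSuperExponentialEnergyTailsPowerLedger
import Summits.AtomisticToContinuum.HydrodynamicLimit.Theorems.OneFlightGossipEngineSuperExponentialEnergyTailsMomentStatics
import Summits.AtomisticToContinuum.HydrodynamicLimit.Theorems.OneFlightGossipEngineSuperExponentialEnergyTailsMomentContinuity
import HarnessLib

/-!
# Regularity and the exact power ledger of the true-law velocity moments (stub R of line `Sketch`,
# crux `SuperExponentialEnergyTails`, stmt-AtomisticToContinuum-17701), stage 4/4: assembly

Stub worker file for the registered stub `stub_momentRegularity : MomentRegularity` of the line lead's skeleton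
`Cruxes/SuperExponentialEnergyTails/Lines/Sketch.lean` (lead prover-line-stmt-AtomisticToContinuum-17701-0).  Pure
composition of the three landed stages:

* `momentPowerLedger` (`…SuperExponentialEnergyTailsPowerLedger`): the field `ledger`, for `0 < σ < 1/2`;
* `momentStatics` (`…SuperExponentialEnergyTailsMomentStatics`): the fields `mass`, `energy`, `lyapunov`, `initial`,
  for `σ ≤ 1/2`;
* `momentContinuity` (`…SuperExponentialEnergyTailsMomentContinuity`): the fields `finite`, `continuousOn`, for
  `0 < σ ≤ 1/2`.

`MomentRegularity` quantifies over continuous data `a₀, θ₀ > 0`, `u₀` and `0 < σ < 1/2`, so every stage applies.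
The statement is UNCONDITIONAL (no conjecture-grade input): `N`-side measure theory over the hard-sphere prelude.
-/

noncomputable section

namespace Summit.AtomisticToContinuum.HydrodynamicLimit.Theorems.SuperExponentialEnergyTailsMomentRegularity

open Summit.AtomisticToContinuum.HydrodynamicLimit.Theorems.SuperExponentialEnergyTailsLine
  (velMoment preMomentSum postMomentSum pairMomentSum MomentRegularityFor MomentRegularity)

/-- **Stub R of line `Sketch` (crux stmt-AtomisticToContinuum-17701) — `MomentRegularity`.**  For all continuous
data `a₀, θ₀ > 0`, `u₀` and every reduced density `0 < σ < 1/2`, the normalised velocity moments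
`M_p(s) = velMoment Φ λ_N p s` of the local Gibbs law `λ_N = localGibbsLaw σ a₀ u₀ θ₀ N Φ` transported by ANY
hard-sphere flow `Φ` of `N + 1` spheres of diameter `hsDiameter σ N` on `𝕋³` are finite and continuous in time on
`[0, ∞)`, with `M_0 ≡ 1`, `M_2(s) = M_2(0)`, Lyapunov's interpolation, the Gaussian initial class
`M_{2k}(0) ≤ C₀ A₀ᵏ k!`, and the exact power ledger `M_p(s') + preMomentSum p (s,s'] = M_p(s) + postMomentSum p (s,s']`
(assembled from `momentContinuity`, `momentStatics`, `momentPowerLedger`). [folklore] -/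
theorem stub_momentRegularity : MomentRegularity := by
  intro a₀ θ₀ u₀ ha hθ hu ha0 hθ0 σ hσ hσ2
  obtain ⟨hmass, henergy, hlyap, hinit⟩ := momentStatics a₀ θ₀ u₀ ha hθ hu ha0 hθ0 σ hσ2.le
  obtain ⟨hfin, hcont⟩ := momentContinuity a₀ θ₀ u₀ ha hθ hu ha0 hθ0 σ hσ hσ2.le
  exact ⟨hfin, hcont, hmass, henergy, hlyap, hinit,
    fun N Φ p s s' hs hss' => momentPowerLedger a₀ θ₀ u₀ σ hσ hσ2 N Φ p s s' hs hss'⟩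

end Summit.AtomisticToContinuum.HydrodynamicLimit.Theorems.SuperExponentialEnergyTailsMomentRegularity

end
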